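import Mathlib
import Literature.Probability.LatticeModels.TriangularLattice
import Literature.Probability.Percolation.TriHexagon
import Literature.Analysis.FunctionSpaces.PoissonPointProcess

/-!
# Sketch — first lemmas of three crux ideas for `QuadrupoleSelectionRule` (stmt-CriticalPhenomena-7029)

Planner sketch (crux-ideate round 1, ideator 1). Statements only (`def … : Prop`), over existing
declarations; nothing here is a route item.

* Card A `average-first-odd-sector-gap`: `PartialRotationInvariance` (+ `PartialRotationGeometry`,
  `PoissonPartialRotationInvariance`) — the exact partial-rotation symmetry Φ_{z,r} of the leg laws.
* Card B `leg-continuity-robust-gap`: `BootstrapPrinciple`, `RobustBlockDecay` — the continuity-method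
  skeleton and the robustness of a block decay rate.
* Card C `poisson-hub-ward-identity`: `CocircSimilarityCovariance`, `CocircStrainSpinTwo` — similarities
  induce no Delaunay flips; the strain response of the cocircularity form is spin 2.
-/

noncomputable section

namespace Summit.CriticalPhenomena.CardyFormulaZ2.Cruxes.QuadrupoleSelectionRule.IdeasR1K1

open MeasureTheory ProbabilityTheory
open Literature.Probability.LatticeModels Literature.Probability.Percolation
open Literature.Analysis.FunctionSpaces

/-! ### Card A — partial rotations -/

/-- Rotation by `60°` of a jitter vector. -/
def rot60 (v : ℝ × ℝ) : ℝ × ℝ :=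
  (v.1 / 2 - Real.sqrt 3 / 2 * v.2, Real.sqrt 3 / 2 * v.1 + v.2 / 2)

/-- Partial rotation of a jitter field `ξ : Site 2 → ℝ × ℝ`: the sites of `S` receive the rotated jitter of
their `hexRot k`-preimage, the other sites keep theirs. (`TriHexagon.hexRot k` = lattice rotation by `60°` about the
site `(k,k)`, `Literature.Probability.Percolation.hexRot`.) -/
def partialRot (k : ℕ) (S : Set (Site 2)) [DecidablePred (· ∈ S)] (ξ : Site 2 → ℝ × ℝ) :
    Site 2 → ℝ × ℝ :=
  fun w => if w ∈ S then rot60 (ξ ((TriHexagon.hexRot k).symm w)) else ξ w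

/-- **Card A, first lemma (jitter-leg instance of the partial-rotation symmetry Φ).** The i.i.d. standard
Gaussian jitter field of the triangular lattice (the environment randomness of `JitteredTriangularLeg`)
is invariant in law under `partialRot k S` for every `hexRot k`-invariant set of sites `S` (e.g. the sites
within distance `r` of `triEmbed (k,k)`): rotating the jitters INSIDE a lattice-centred disc by `60°`
while freezing everything outside preserves the joint law. Isotropy of `N(0,1)²` + reindexing by a
bijection of `S`. -/
def PartialRotationInvariance : Prop :=
  ∀ (k : ℕ) (S : Set (Site 2)) [DecidablePred (· ∈ S)], (TriHexagon.hexRot k) '' S = S →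
    (Measure.infinitePi (fun _ : Site 2 => (gaussianReal 0 1).prod (gaussianReal 0 1))).map
        (partialRot k S)
      = Measure.infinitePi (fun _ : Site 2 => (gaussianReal 0 1).prod (gaussianReal 0 1))

/-- **Card A, geometric half.** The jittered position attached to the rotated site `hexRot k v` by the
rotated jitter is the Euclidean rotation by `60°` (multiplication by `triZeta = e^{iπ/3}`) about the centre
`triEmbed (k,k)` of the old jittered position of `v`: so `partialRot` realises "rotate the point set inside
the disc, keep the outside" on the jittered lattice `{triEmbed v + σ ξ_v}`. -/
def PartialRotationGeometry : Prop :=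
  ∀ (k : ℕ) (σ : ℝ) (v : Site 2) (ξ : ℝ × ℝ),
    triEmbed (TriHexagon.hexRot k v) + (σ : ℂ) * (((rot60 ξ).1 : ℂ) + ((rot60 ξ).2 : ℂ) * Complex.I)
      = triEmbed ![(k : ℤ), (k : ℤ)] + triZeta * (triEmbed v + (σ : ℂ) * ((ξ.1 : ℂ) + (ξ.2 : ℂ) * Complex.I) - triEmbed ![(k : ℤ), (k : ℤ)])

/-- **Card A, Poisson-hub instance.** For a Poisson process of Lebesgue intensity on `ℂ`, any measurable
map `Φ` of configurations that acts as "rotate the points inside the open disc `B(z,r)` by the angle `θ`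
about `z`, keep the points outside" (characterised through the counting maps) preserves the law — for
EVERY angle `θ` and centre `z` (mapping theorem + Rényi uniqueness; Lebesgue measure is invariant under the
piecewise isometry). -/
def PoissonPartialRotationInvariance : Prop :=
  ∀ (P : Measure (PointConfig ℂ)) (z : ℂ) (r θ : ℝ) (Φ : PointConfig ℂ → PointConfig ℂ),
    IsPoissonPointProcess (volume : Measure ℂ) P → Measurable Φ →
    (∀ (c : PointConfig ℂ) (s : Set ℂ), MeasurableSet s →
      (Φ c).count s =
        c.count ((fun w : ℂ => if dist w z < r then z + Complex.exp ((θ : ℂ) * Complex.I) * (w - z) else w) ⁻¹' s)) →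
    P.map Φ = P

/-! ### Card B — continuity method with a robust gap -/

/-- **Card B, first lemma (the continuity/bootstrap principle in the leg parameter).** If a continuous
defect `u` on `[0,1]` starts below `ε`, and on every initial interval where it stays below the threshold
`η` it obeys the improved bound `u s ≤ ε + ε' s`, then (as `ε + ε' < η`) the improved bound holds on all
of `[0,1]`. In the line: `u(t)` = mesoscopic distance of leg-model `t` from CLE₆ (arm/crossing statistics
on scales `[δ^a, 1]`), "below `η`" = close enough for the robust odd-sector gap, `ε'` = the resulting bound
on the annealed Russo derivative, `ε → 0` with `δ` by Smirnov/Camia–Newman at `t = 0`. -/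
def BootstrapPrinciple : Prop :=
  ∀ (u : ℝ → ℝ) (ε ε' η : ℝ), ContinuousOn u (Set.Icc 0 1) → 0 ≤ ε' → u 0 ≤ ε → ε + ε' < η →
    (∀ t ∈ Set.Icc (0 : ℝ) 1, (∀ s ∈ Set.Icc (0 : ℝ) t, u s < η) → ∀ s ∈ Set.Icc (0 : ℝ) t, u s ≤ ε + ε' * s) →
    ∀ t ∈ Set.Icc (0 : ℝ) 1, u t ≤ ε + ε' * t

/-- **Card B, second lemma (robustness of a block decay rate).** A quasi-submultiplicative two-scale
quantity (`a m n ≤ C · a m k · a k n`, think: the operator norm of the annulus four-arm transfer from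
dyadic scale `m` to scale `n` restricted to the σ-odd, spin-`mℤ` sector, normalised by the four-arm
probability) whose one-block values are `≤ q` decays geometrically with ratio `C q` along blocks. With
`q = q_{CLE₆}(L) + (perturbation)` this is how the continuum gap survives an `O(1)`-small perturbation of
the kernels: the needed rate `3/4` sits a full unit below the CLE₆ rate `7/4`. -/
def RobustBlockDecay : Prop :=
  ∀ (C q : ℝ) (L : ℕ) (a : ℕ → ℕ → ℝ), 0 ≤ C → (∀ m n, 0 ≤ a m n) →
    (∀ m k n, m ≤ k → k ≤ n → a m n ≤ C * a m k * a k n) →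
    (∀ k, a k (k + L) ≤ q) →
    ∀ n : ℕ, a 0 (n * L) ≤ a 0 0 * (C * q) ^ n

/-! ### Card C — the cocircularity form: similarities do not flip, strain flips with spin 2 -/

/-- The Delaunay cocircularity form of four points of `ℂ`: the `4 × 4` determinant with rows
`(Re zᵢ, Im zᵢ, |zᵢ|², 1)`; it vanishes iff the four points are cocircular or collinear, and its sign
decides which diagonal of the quadrilateral is Delaunay. -/
def cocirc (z : Fin 4 → ℂ) : ℝ :=
  Matrix.det (Matrix.of fun i j => (![(z i).re, (z i).im, Complex.normSq (z i), 1] : Fin 4 → ℝ) j)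

/-- **Card C, first lemma.** The cocircularity form is a relative invariant of weight `|a|⁴` under the
similarities `w ↦ a w + c` of the plane: translations, rotations and dilations — the conformal Killing
motions — flip NO Delaunay quadrilateral. (Hence, to first order, an infinitesimal diffeomorphism changes
the Delaunay triangulation only through its strain `∂̄h`, and an intensity/conformal-factor change not at
all: the metric/measure split behind the hub's Ward identity.) -/
def CocircSimilarityCovariance : Prop :=
  ∀ (z : Fin 4 → ℂ) (a c : ℂ), cocirc (fun i => a * z i + c) = Complex.normSq a ^ 2 * cocirc z

/-- **Card C, second lemma (the flip kernel is spin 2).** Straining a rotated quadrilateral by the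
Beltrami coefficient `b` is the same, for the cocircularity form, as straining the original quadrilateral by
`b e^{-2iθ}`: the first-order flip response of a quad to a strain is `Re (b̄ · q(Q))` with
`q(e^{iθ} Q) = e^{2iθ} q(Q)` — the quadrupole. Immediate from `CocircSimilarityCovariance` with `|a| = 1`. -/
def CocircStrainSpinTwo : Prop :=
  ∀ (z : Fin 4 → ℂ) (b : ℂ) (θ s : ℝ),
    cocirc (fun i => Complex.exp ((θ : ℂ) * Complex.I) * z i
        + (s : ℂ) * b * (starRingEnd ℂ) (Complex.exp ((θ : ℂ) * Complex.I) * z i))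
      = cocirc (fun i => z i + (s : ℂ) * (b * Complex.exp (-(2 * (θ : ℂ)) * Complex.I)) * (starRingEnd ℂ) (z i))

/-! ### Sanity: two of the statements are provable on the spot -/

/-- `RobustBlockDecay` holds (chaining). -/
theorem robustBlockDecay_holds : RobustBlockDecay := by
  intro C q L a hC ha hsub hq n
  induction n with
  | zero => simp
  | succ n ih =>
    have h1 : a 0 ((n + 1) * L) ≤ C * a 0 (n * L) * a (n * L) ((n + 1) * L) :=
      hsub 0 (n * L) ((n + 1) * L) (Nat.zero_le _) (by nlinarith)
    have h2 : a (n * L) ((n + 1) * L) ≤ q := by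
      have := hq (n * L)
      simpa [Nat.succ_mul, Nat.add_comm] using this
    have hq0 : 0 ≤ q := le_trans (ha _ _) (hq 0)
    calc a 0 ((n + 1) * L) ≤ C * a 0 (n * L) * a (n * L) ((n + 1) * L) := h1
      _ ≤ C * a 0 (n * L) * q := by
          apply mul_le_mul_of_nonneg_left h2
          exact mul_nonneg hC (ha _ _)
      _ ≤ C * (a 0 0 * (C * q) ^ n) * q := by
          apply mul_le_mul_of_nonneg_right _ hq0
          exact mul_le_mul_of_nonneg_left ih hC
      _ = a 0 0 * (C * q) ^ (n + 1) := by ring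

end Summit.CriticalPhenomena.CardyFormulaZ2.Cruxes.QuadrupoleSelectionRule.IdeasR1K1

end
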